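import Summits.Ventures.WeilGRH.TwoPrimeReflectionTransfer
import Summits.Ventures.WeilGRH.TwoPrimeReflectionCriterion
import Summits.RiemannHypothesis.RiemannHypothesis.Theorems.WeilPositivityLogTwo
import Literature.NumberTheory.LFunctions.WeilTwoPrimePos59
import HarnessLib

/-!
# GRH arm (rh-explicit, venture WeilGRH): PROVED rungs on the two-prime window (`59/100`, `log 2`)

Numerical instances of `weilPositivityOnChar_transfer_reflection_two_prime` at the two `ζ` rungs of the
window `log 3 ≤ 2a ≤ 2 log 2` that are kernel-checked in the tree: `weilPositivityOn_59_100` (R2c) and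
`EvenWinsBeyondArch.weilPositivityOn_log_two` (R4a). With `k₃' = log 3/√3 ≤ 0.6343` the budget for the
prime `3` is `δ = 0` if `χ(3) = 1`, `δ = 0.6343` if `χ(3) = 0` (`3 ∣ q`), `δ = 1.2686` in general:

* `a = 59/100`: `WeilPositivityOnChar χ (59/100)` for EVERY Dirichlet character of EVERY modulus `q ≥ 36`;
  for `q ≥ 21` with `3 ∣ q`; for `q ≥ 12` when `χ(3) = 1`.
* `a = log 2`: `WeilPositivityOnChar χ (log 2)` for EVERY character of EVERY modulus `q ≥ 70`;
  for `q ≥ 36` with `3 ∣ q`; for `q ≥ 20` when `χ(3) = 1`.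

These are the first TREE THEOREMS of the GRH arm beyond the `ζ` base rung `(log 3)/2` (the cell's
two-prime reflection certificates, EXTREMALS/GRH/reflection23-CERT, reach lower conductors by treating
`n = 3` with a second reflection; here `n = 3` is paid crudely, `2|k(log 3)| ≤ ∫_{A ∪ −A}|g|²`).
Constants: at `59/100` through `e^{59/100} ∈ [1.8039884, 1.8039885]` (`C_M ≤ 0.206478`,
`C_A ≤ 0.504178`, `I_A ≥ 0.504029`); at `log 2` exactly `C_M = 0`, `C_A = (3/4 + log 2)/2`,
`I_A = 3√2 log 2/8 + √2/4`. Margins ≥ 1.3 %.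

## References

* A. Weil (1952), (11) and the «lemme» p. 262; H. Yoshida (1992) §6.
-/

noncomputable section

open Complex Filter Set MeasureTheory
open scoped Real Topology ComplexConjugate

namespace Summit.Ventures.WeilGRH

open Literature.NumberTheory.LFunctions

variable {q : ℕ}

/-! ## The rung `59/100` -/

/-- The rung `59/100` from the bounded two-budget curve criterion: `B ≤ log q`, `1 + δ ≤ B`,
`(log 3/√3)‖1 − χ(3)‖ ≤ δ`, `σ₀ ≤ ‖1 − χ(2)‖² ≤ σ₁ ≤ 4`, rational checks at `σ₀, σ₁`.
[cite: Weil1952FormulesExplicites, the «lemme» p. 262; Yoshida1992 §6] -/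
theorem weilPositivityOnChar_fiftynine_of_curve [NeZero q] (hq1 : q ≠ 1)
    (χ : DirichletCharacter ℂ q) {B δ σ₀ σ₁ : ℝ} (hBq : B ≤ Real.log q) (hB1 : 1 + δ ≤ B)
    (hδ : Real.log 3 / Real.sqrt 3 * ‖1 - χ (3 : ZMod q)‖ ≤ δ)
    (hσ₀ : σ₀ ≤ ‖1 - χ (2 : ZMod q)‖ ^ 2) (hσ₁ : ‖1 - χ (2 : ZMod q)‖ ^ 2 ≤ σ₁) (hσ₀0 : 0 ≤ σ₀)
    (hσ₁4 : σ₁ ≤ 4)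
    (h0 : 2 * (0.206478 * ((B - δ) ^ 2 - 0.49012 ^ 2 * σ₀) +
        2 * B * ((B - δ) * 0.504178 - 0.49012 * (σ₀ / 2) * 0.504029)) ≤
      B * ((B - δ) ^ 2 - 0.49014 ^ 2 * σ₀))
    (h1 : 2 * (0.206478 * ((B - δ) ^ 2 - 0.49012 ^ 2 * σ₁) +
        2 * B * ((B - δ) * 0.504178 - 0.49012 * (σ₁ / 2) * 0.504029)) ≤
      B * ((B - δ) ^ 2 - 0.49014 ^ 2 * σ₁)) :
    WeilPositivityOnChar χ (59 / 100) := by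
  obtain ⟨hCM, hCA, hIA⟩ := fiftynine_constants
  obtain ⟨hk1, hk2⟩ := kprime_bounds
  set k' := Real.log 2 / Real.sqrt 2 with hk'
  set u : ℂ := 1 - χ (2 : ZMod q) with hu
  have hδ0 : 0 ≤ δ := le_trans (by positivity) hδ
  have hB : 0 < B := by linarith
  have hB' : 0 < B - δ := by linarith
  have hk0 : 0 ≤ k' := by linarith
  have hIA0 : (0 : ℝ) ≤ (59 / 100 - (Real.log 2 - 59 / 100)) * Real.cosh (Real.log 2 / 2) / 2 +
      Real.sinh (59 / 100 - Real.log 2 / 2) := by linarith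
  have hend : ∀ s : ℝ, 0 ≤ s → s ≤ 4 →
      2 * (0.206478 * ((B - δ) ^ 2 - 0.49012 ^ 2 * s) +
        2 * B * ((B - δ) * 0.504178 - 0.49012 * (s / 2) * 0.504029)) ≤
          B * ((B - δ) ^ 2 - 0.49014 ^ 2 * s) →
      2 * ((Real.sinh (Real.log 2 - 59 / 100) + (Real.log 2 - 59 / 100)) * ((B - δ) ^ 2 - k' ^ 2 * s) +
        2 * B * ((B - δ) * ((Real.sinh (59 / 100) - Real.sinh (Real.log 2 - 59 / 100) +
          (59 / 100 - (Real.log 2 - 59 / 100))) / 2) -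
          k' * (s / 2) * ((59 / 100 - (Real.log 2 - 59 / 100)) * Real.cosh (Real.log 2 / 2) / 2 +
            Real.sinh (59 / 100 - Real.log 2 / 2)))) ≤ B * ((B - δ) ^ 2 - k' ^ 2 * s) :=
    fun s hs0 hs4 hnum ↦ reflection_criterion_of_bounds₂ hCM hCA hIA (by norm_num) (by linarith) hs0
      hk1 hk2 (by norm_num) hB hB' (by norm_num) (by nlinarith) hnum
  have hcrit := reflection_criterion_interpolate₂ (ρ := u.re) hk0 hIA0 hB.le
    (hend σ₀ hσ₀0 (by linarith) h0) (hend σ₁ (by linarith) hσ₁4 h1) hσ₀ hσ₁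
    (normSq_one_sub_half_le_re (χ.norm_le_one _))
  have hl2 := Real.log_two_lt_d9
  have hl3 := Real.log_three_lt_d9
  have hl2' := Real.log_two_gt_d9
  refine weilPositivityOnChar_transfer_reflection_two_prime (B := B) (κ := k' * ‖u‖) (δ := δ)
    (by linarith) (by linarith) weilPositivityOn_59_100 hq1 χ hBq (by rw [hk', hu]) hδ ?_
    rfl rfl rfl rfl ?_
  · have h2 : ‖u‖ ≤ 2 := by nlinarith [normSq_one_sub_char_le_four χ, norm_nonneg u]
    nlinarith [norm_nonneg u]
  · rw [mul_pow]
    exact hcrit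

/-- **The rung `59/100` for EVERY Dirichlet character of EVERY modulus `q ≥ 36`** (`B = 3.583 ≤ 2 log 6`,
`δ = 1.2686 ≥ 2k₃'`). [cite: Weil1952FormulesExplicites, the «lemme» p. 262; Yoshida1992 §6] -/
theorem weilPositivityOnChar_fiftynine_of_ge_36 (hq : 36 ≤ q) (χ : DirichletCharacter ℂ q) :
    WeilPositivityOnChar χ (59 / 100) := by
  have hq1 : q ≠ 1 := by omega
  haveI : NeZero q := ⟨by omega⟩
  have hBq : (3.583 : ℝ) ≤ Real.log q := by
    have h := Real.log_le_log (by norm_num) (by exact_mod_cast hq : (36 : ℝ) ≤ q)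
    rw [show (36 : ℝ) = 2 ^ 2 * 3 ^ 2 by norm_num, Real.log_mul (by norm_num) (by norm_num),
      Real.log_pow, Real.log_pow] at h
    push_cast at h
    linarith [Real.log_two_gt_d9, Real.log_three_gt_d9]
  have hδ : Real.log 3 / Real.sqrt 3 * ‖1 - χ (3 : ZMod q)‖ ≤ 1.2686 := by
    have := mul_le_mul kthree_le (norm_one_sub_char_three_le χ) (norm_nonneg _) (by norm_num)
    linarith
  exact weilPositivityOnChar_fiftynine_of_curve hq1 χ hBq (by norm_num) hδ
    (sq_nonneg _) (normSq_one_sub_char_le_four χ) le_rfl le_rfl (by norm_num) (by norm_num)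

/-- **The rung `59/100` for every character of a modulus `q ≥ 21` divisible by `3`** (`χ(3) = 0`,
`δ = 0.6343`, `B = 3.044 ≤ log 21`). [cite: Weil1952FormulesExplicites, the «lemme» p. 262; Yoshida1992 §6] -/
theorem weilPositivityOnChar_fiftynine_of_three_dvd (hq : 21 ≤ q) (h3 : 3 ∣ q)
    (χ : DirichletCharacter ℂ q) : WeilPositivityOnChar χ (59 / 100) := by
  have hq1 : q ≠ 1 := by omega
  haveI : NeZero q := ⟨by omega⟩
  have hχ3 : χ (3 : ZMod q) = 0 := by
    refine χ.map_nonunit fun hunit ↦ ?_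
    have hcop := (ZMod.isUnit_iff_coprime 3 q).1 (by exact_mod_cast hunit)
    have := Nat.Coprime.eq_one_of_dvd hcop h3
    omega
  have hBq : (3.044 : ℝ) ≤ Real.log q := by
    have h := Real.log_le_log (by norm_num) (by exact_mod_cast hq : (21 : ℝ) ≤ q)
    have h7 : Real.log 2400 < Real.log 2401 := Real.log_lt_log (by norm_num) (by norm_num)
    rw [show (2401 : ℝ) = 7 ^ 4 by norm_num, Real.log_pow,
      show (2400 : ℝ) = 2 ^ 5 * 3 * 5 ^ 2 by norm_num, Real.log_mul (by norm_num) (by norm_num),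
      Real.log_mul (by norm_num) (by norm_num), Real.log_pow, Real.log_pow] at h7
    rw [show (21 : ℝ) = 3 * 7 by norm_num, Real.log_mul (by norm_num) (by norm_num)] at h
    push_cast at h h7
    linarith [Real.log_two_gt_d9, Real.log_three_gt_d9, Real.log_five_gt_d9]
  have hδ : Real.log 3 / Real.sqrt 3 * ‖1 - χ (3 : ZMod q)‖ ≤ 0.6343 := by
    rw [hχ3, sub_zero, norm_one, mul_one]; exact kthree_le
  exact weilPositivityOnChar_fiftynine_of_curve hq1 χ hBq (by norm_num) hδ
    (sq_nonneg _) (normSq_one_sub_char_le_four χ) le_rfl le_rfl (by norm_num) (by norm_num)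

/-- **The rung `59/100` for `q ≥ 12` when `χ(3) = 1`** (`δ = 0`, `B = 2.484 ≤ log 12`).
[cite: Weil1952FormulesExplicites, the «lemme» p. 262; Yoshida1992 §6] -/
theorem weilPositivityOnChar_fiftynine_of_trivial_at_three (hq : 12 ≤ q)
    (χ : DirichletCharacter ℂ q) (hχ : χ (3 : ZMod q) = 1) : WeilPositivityOnChar χ (59 / 100) := by
  have hq1 : q ≠ 1 := by omega
  haveI : NeZero q := ⟨by omega⟩
  have hBq : (2.484 : ℝ) ≤ Real.log q := by
    have h := Real.log_le_log (by norm_num) (by exact_mod_cast hq : (12 : ℝ) ≤ q)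
    rw [show (12 : ℝ) = 2 ^ 2 * 3 by norm_num, Real.log_mul (by norm_num) (by norm_num),
      Real.log_pow] at h
    push_cast at h
    linarith [Real.log_two_gt_d9, Real.log_three_gt_d9]
  have hδ : Real.log 3 / Real.sqrt 3 * ‖1 - χ (3 : ZMod q)‖ ≤ 0 := by
    rw [hχ, sub_self, norm_zero, mul_zero]
  exact weilPositivityOnChar_fiftynine_of_curve hq1 χ hBq (by norm_num) hδ
    (sq_nonneg _) (normSq_one_sub_char_le_four χ) le_rfl le_rfl (by norm_num) (by norm_num)

/-! ## The rung `log 2` -/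

/-- The rung `log 2` from the bounded two-budget curve criterion.
[cite: Weil1952FormulesExplicites, the «lemme» p. 262; Yoshida1992 §6] -/
theorem weilPositivityOnChar_log_two_of_curve [NeZero q] (hq1 : q ≠ 1)
    (χ : DirichletCharacter ℂ q) {B δ σ₀ σ₁ : ℝ} (hBq : B ≤ Real.log q) (hB1 : 1 + δ ≤ B)
    (hδ : Real.log 3 / Real.sqrt 3 * ‖1 - χ (3 : ZMod q)‖ ≤ δ)
    (hσ₀ : σ₀ ≤ ‖1 - χ (2 : ZMod q)‖ ^ 2) (hσ₁ : ‖1 - χ (2 : ZMod q)‖ ^ 2 ≤ σ₁) (hσ₀0 : 0 ≤ σ₀)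
    (hσ₁4 : σ₁ ≤ 4)
    (h0 : 2 * (0 * ((B - δ) ^ 2 - 0.49012 ^ 2 * σ₀) +
        2 * B * ((B - δ) * 0.721574 - 0.49012 * (σ₀ / 2) * 0.721149)) ≤
      B * ((B - δ) ^ 2 - 0.49014 ^ 2 * σ₀))
    (h1 : 2 * (0 * ((B - δ) ^ 2 - 0.49012 ^ 2 * σ₁) +
        2 * B * ((B - δ) * 0.721574 - 0.49012 * (σ₁ / 2) * 0.721149)) ≤
      B * ((B - δ) ^ 2 - 0.49014 ^ 2 * σ₁)) :
    WeilPositivityOnChar χ (Real.log 2) := by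
  obtain ⟨hCM, hCA, hIA⟩ := log_two_constants
  obtain ⟨hk1, hk2⟩ := kprime_bounds
  set k' := Real.log 2 / Real.sqrt 2 with hk'
  set u : ℂ := 1 - χ (2 : ZMod q) with hu
  have hδ0 : 0 ≤ δ := le_trans (by positivity) hδ
  have hB : 0 < B := by linarith
  have hB' : 0 < B - δ := by linarith
  have hk0 : 0 ≤ k' := by linarith
  have hIA0 : (0 : ℝ) ≤ (Real.log 2 - (Real.log 2 - Real.log 2)) * Real.cosh (Real.log 2 / 2) / 2 +
      Real.sinh (Real.log 2 - Real.log 2 / 2) := by linarith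
  have hend : ∀ s : ℝ, 0 ≤ s → s ≤ 4 →
      2 * (0 * ((B - δ) ^ 2 - 0.49012 ^ 2 * s) +
        2 * B * ((B - δ) * 0.721574 - 0.49012 * (s / 2) * 0.721149)) ≤
          B * ((B - δ) ^ 2 - 0.49014 ^ 2 * s) →
      2 * ((Real.sinh (Real.log 2 - Real.log 2) + (Real.log 2 - Real.log 2)) *
          ((B - δ) ^ 2 - k' ^ 2 * s) +
        2 * B * ((B - δ) * ((Real.sinh (Real.log 2) - Real.sinh (Real.log 2 - Real.log 2) +
          (Real.log 2 - (Real.log 2 - Real.log 2))) / 2) -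
          k' * (s / 2) * ((Real.log 2 - (Real.log 2 - Real.log 2)) * Real.cosh (Real.log 2 / 2) / 2 +
            Real.sinh (Real.log 2 - Real.log 2 / 2)))) ≤ B * ((B - δ) ^ 2 - k' ^ 2 * s) :=
    fun s hs0 hs4 hnum ↦ reflection_criterion_of_bounds₂ hCM hCA hIA (by norm_num) (by linarith) hs0
      hk1 hk2 (by norm_num) hB hB' le_rfl (by nlinarith) hnum
  have hcrit := reflection_criterion_interpolate₂ (ρ := u.re) hk0 hIA0 hB.le
    (hend σ₀ hσ₀0 (by linarith) h0) (hend σ₁ (by linarith) hσ₁4 h1) hσ₀ hσ₁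
    (normSq_one_sub_half_le_re (χ.norm_le_one _))
  have hlog23 : Real.log 3 ≤ 2 * Real.log 2 := by
    rw [← Real.log_rpow (by norm_num), show ((2 : ℝ) ^ (2 : ℝ)) = 4 by norm_num]
    exact Real.log_le_log (by norm_num) (by norm_num)
  refine weilPositivityOnChar_transfer_reflection_two_prime (B := B) (κ := k' * ‖u‖) (δ := δ)
    hlog23 le_rfl Summit.RiemannHypothesis.RiemannHypothesis.Theorems.EvenWinsBeyondArch.weilPositivityOn_log_two
    hq1 χ hBq (by rw [hk', hu]) hδ ?_ rfl rfl rfl rfl ?_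
  · have h2 : ‖u‖ ≤ 2 := by nlinarith [normSq_one_sub_char_le_four χ, norm_nonneg u]
    nlinarith [norm_nonneg u]
  · rw [mul_pow]
    exact hcrit

/-- **The rung `log 2` for EVERY Dirichlet character of EVERY modulus `q ≥ 70`** (`B = 4.248 ≤
log 2 + log 5 + log 7`, `δ = 1.2686`). [cite: Weil1952FormulesExplicites, the «lemme» p. 262; Yoshida1992 §6] -/
theorem weilPositivityOnChar_log_two_of_ge_70 (hq : 70 ≤ q) (χ : DirichletCharacter ℂ q) :
    WeilPositivityOnChar χ (Real.log 2) := by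
  have hq1 : q ≠ 1 := by omega
  haveI : NeZero q := ⟨by omega⟩
  have hBq : (4.248 : ℝ) ≤ Real.log q := by
    have h := Real.log_le_log (by norm_num) (by exact_mod_cast hq : (70 : ℝ) ≤ q)
    have h7 : Real.log 2400 < Real.log 2401 := Real.log_lt_log (by norm_num) (by norm_num)
    rw [show (2401 : ℝ) = 7 ^ 4 by norm_num, Real.log_pow,
      show (2400 : ℝ) = 2 ^ 5 * 3 * 5 ^ 2 by norm_num, Real.log_mul (by norm_num) (by norm_num),
      Real.log_mul (by norm_num) (by norm_num), Real.log_pow, Real.log_pow] at h7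
    rw [show (70 : ℝ) = 2 * 5 * 7 by norm_num, Real.log_mul (by norm_num) (by norm_num),
      Real.log_mul (by norm_num) (by norm_num)] at h
    push_cast at h h7
    linarith [Real.log_two_gt_d9, Real.log_three_gt_d9, Real.log_five_gt_d9]
  have hδ : Real.log 3 / Real.sqrt 3 * ‖1 - χ (3 : ZMod q)‖ ≤ 1.2686 := by
    have := mul_le_mul kthree_le (norm_one_sub_char_three_le χ) (norm_nonneg _) (by norm_num)
    linarith
  exact weilPositivityOnChar_log_two_of_curve hq1 χ hBq (by norm_num) hδ
    (sq_nonneg _) (normSq_one_sub_char_le_four χ) le_rfl le_rfl (by norm_num) (by norm_num)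

/-- **The rung `log 2` for every character of a modulus `q ≥ 36` divisible by `3`** (`χ(3) = 0`,
`δ = 0.6343`, `B = 3.583 ≤ 2 log 6`). [cite: Weil1952FormulesExplicites, the «lemme» p. 262; Yoshida1992 §6] -/
theorem weilPositivityOnChar_log_two_of_three_dvd (hq : 36 ≤ q) (h3 : 3 ∣ q)
    (χ : DirichletCharacter ℂ q) : WeilPositivityOnChar χ (Real.log 2) := by
  have hq1 : q ≠ 1 := by omega
  haveI : NeZero q := ⟨by omega⟩
  have hχ3 : χ (3 : ZMod q) = 0 := by
    refine χ.map_nonunit fun hunit ↦ ?_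
    have hcop := (ZMod.isUnit_iff_coprime 3 q).1 (by exact_mod_cast hunit)
    have := Nat.Coprime.eq_one_of_dvd hcop h3
    omega
  have hBq : (3.583 : ℝ) ≤ Real.log q := by
    have h := Real.log_le_log (by norm_num) (by exact_mod_cast hq : (36 : ℝ) ≤ q)
    rw [show (36 : ℝ) = 2 ^ 2 * 3 ^ 2 by norm_num, Real.log_mul (by norm_num) (by norm_num),
      Real.log_pow, Real.log_pow] at h
    push_cast at h
    linarith [Real.log_two_gt_d9, Real.log_three_gt_d9]
  have hδ : Real.log 3 / Real.sqrt 3 * ‖1 - χ (3 : ZMod q)‖ ≤ 0.6343 := by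
    rw [hχ3, sub_zero, norm_one, mul_one]; exact kthree_le
  exact weilPositivityOnChar_log_two_of_curve hq1 χ hBq (by norm_num) hδ
    (sq_nonneg _) (normSq_one_sub_char_le_four χ) le_rfl le_rfl (by norm_num) (by norm_num)

/-- **The rung `log 2` for `q ≥ 20` when `χ(3) = 1`** (`δ = 0`, `B = 2.995 ≤ log 20`).
[cite: Weil1952FormulesExplicites, the «lemme» p. 262; Yoshida1992 §6] -/
theorem weilPositivityOnChar_log_two_of_trivial_at_three (hq : 20 ≤ q)
    (χ : DirichletCharacter ℂ q) (hχ : χ (3 : ZMod q) = 1) : WeilPositivityOnChar χ (Real.log 2) := by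
  have hq1 : q ≠ 1 := by omega
  haveI : NeZero q := ⟨by omega⟩
  have hBq : (2.995 : ℝ) ≤ Real.log q := by
    have h := Real.log_le_log (by norm_num) (by exact_mod_cast hq : (20 : ℝ) ≤ q)
    rw [show (20 : ℝ) = 2 ^ 2 * 5 by norm_num, Real.log_mul (by norm_num) (by norm_num),
      Real.log_pow] at h
    push_cast at h
    linarith [Real.log_two_gt_d9, Real.log_five_gt_d9]
  have hδ : Real.log 3 / Real.sqrt 3 * ‖1 - χ (3 : ZMod q)‖ ≤ 0 := by
    rw [hχ, sub_self, norm_zero, mul_zero]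
  exact weilPositivityOnChar_log_two_of_curve hq1 χ hBq (by norm_num) hδ
    (sq_nonneg _) (normSq_one_sub_char_le_four χ) le_rfl le_rfl (by norm_num) (by norm_num)

end Summit.Ventures.WeilGRH
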